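import Summits.Ventures.Crystal3D.Theorems.StickyWulffConstantCoaxialWallLawTwoRowsCertifiedA
import Summits.Ventures.Crystal3D.Theorems.StickyWulffConstantCoaxialWallLawOnSiteBridge
import HarnessLib

/-!
# The crux `CoaxialWallLaw` from `P5Exhaustion`, the ON-SITE FACT over U-W(4) and the two TAILS, at `(v2(A), 9/2)`

HONEST FRAMING. Venture `Summits/Ventures/Crystal3D` (cell `crystal3d-full`), helper `--supports` the crux
`CoaxialWallLaw` of `route-Ventures-StickyWulffConstant` (REGISTERED line `WallLedgerF`).  Rung credit; F-C1 not
moved; CONDITIONAL on named facts; grade COMPUTATIONAL (through `…TwoRowsCertifiedA`: certified `kissingGap_250`,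
`kissingClassification_250`, `StarFar.starPairFar_holds`).  cf-p1 ORDER 2026-08-28T21:28:15Z for 19481-p2 g8: with the
on-site bridge (`…OnSiteBridge`) the two census rows of the capstone `coaxialWallLaw_of_twoRows_v2A_nineHalves` are
replaced by the ON-SITE FACT `EndRowOnSiteA v2 (9/2) (barlowWindowUniverse 4)` (the object PREREG-F-CERT enumerates:
lit g16 / cf-p2, STEP-1/2 maxima `1783/420 = 4.2452 < 9/2`) and the two TAILS `EndRowTwinTailA` / `EndRowTransTailA`.

* `coaxialWallLaw_of_onSiteA_certified` — any version, `0 < s_F ≤ 2√6`, any `vmax`;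
* **`coaxialWallLaw_of_onSiteA_v2A_nineHalves`** : `P5Exhaustion → EndRowOnSiteA v2 (9/2) (barlowWindowUniverse 4) →
  EndRowTwinTailA v2 (9/2) (barlowWindowUniverse 4) → EndRowTransTailA v2 (9/2) (barlowWindowUniverse 4) → CoaxialWallLaw`.
LANE F's BY-NAME DEBTS after this file: {`P5Exhaustion` (E1, cf-p2), the on-site fact (certificate), the two tails
(theorems, OPEN)}.
WHAT THIS IS NOT: none of the three hypotheses is proved here; F-C1 not moved.
-/

noncomputable section

namespace Summit.Ventures.Crystal3D.Theorems

open Summit.Ventures.Crystal3D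

/-- **The crux from `P5Exhaustion`, the on-site fact over U-W(`vmax`) and the two tails**, any version and constant
`0 < s_F ≤ 2√6`, kissing facts certified. -/
theorem coaxialWallLaw_of_onSiteA_certified (ver : WordVersion) (hE1 : P5Exhaustion) {sF : ℝ} (hsF : 0 < sF)
    (hsF' : sF ≤ 2 * Real.sqrt 6) (vmax : ℕ) (hon : EndRowOnSiteA ver sF (barlowWindowUniverse vmax))
    (htailW : EndRowTwinTailA ver sF (barlowWindowUniverse vmax))
    (htailT : EndRowTransTailA ver sF (barlowWindowUniverse vmax)) :
    Summit.Ventures.Crystal3D.Theses.StickyWulffConstant.CoaxialWallLaw :=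
  coaxialWallLaw_of_twoRowsA_certified ver hE1 hsF hsF' (endRowsA_of_onSiteA_barlowWindowUniverse hon htailT htailW).1
    (endRowsA_of_onSiteA_barlowWindowUniverse hon htailT htailW).2

/-- **THE LANE-F CAPSTONE AT THE KEY OF RECORD `(v2(A), r = 1)`, `s_F* = 9/2`, UNIVERSE U-W(4):** the crux from
`P5Exhaustion`, the on-site fact and the two tails. -/
theorem coaxialWallLaw_of_onSiteA_v2A_nineHalves (hE1 : P5Exhaustion)
    (hon : EndRowOnSiteA WordVersion.v2 (9 / 2) (barlowWindowUniverse 4))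
    (htailW : EndRowTwinTailA WordVersion.v2 (9 / 2) (barlowWindowUniverse 4))
    (htailT : EndRowTransTailA WordVersion.v2 (9 / 2) (barlowWindowUniverse 4)) :
    Summit.Ventures.Crystal3D.Theses.StickyWulffConstant.CoaxialWallLaw :=
  coaxialWallLaw_of_onSiteA_certified WordVersion.v2 hE1 (by norm_num) nine_halves_le_two_sqrt_six 4 hon htailW htailT

end Summit.Ventures.Crystal3D.Theorems

end
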